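import Summits.ResolutionOfSingularities.ResolutionOfSingularities.Theorems.AQSHeightTwoSlopeFiltration
import HarnessLib

/-!
# The binomial face of `f` along a weighted filtration: reading it modulo `𝔪` and lifting it

Route `ResolutionOfSingularities/WeightedInvariant`, door crux `HypersurfaceCentreConstruction`
(stmt-ResolutionOfSingularities-19897) — OURS, helper; e-ladder `e = 1`, piece **(o25-δ)** «separable base change of the
Abramovich–Quek–Schober centre in the kernel» (res-D-pv-025 AS stub-10; CHAIN w43 v4.18 (3)), brick **(δ1a)**.

In a two-dimensional regular local ring `T` with regular system of parameters `(x, y)` and weights `(1, b)`, the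
`(1,b)`-FACE of `f ∈ 𝒥_{bν}((x,y);(1,b))` is the layer of weight `bν` of any unit expansion of `f`
(`LocalGameEFTNewton.exists_unitExpansion`): exponents `(bk, ν-k)`, `k ≤ ν`.  The BINOMIAL FACE FORMS are the sums
`Σ_{k ≤ ν} q_k x^{bk} y^{ν-k}` — e.g. `c·(y - λ x^b)^ν` (`q_k = c·C(ν,k)·(-λ)^k`, `mul_sub_pow_eq_sum`) and, for `b = 1`,
`c·(s x + t y)^ν` (`q_k = c·C(ν,k)·s^k t^{ν-k}`, `mul_linear_pow_eq_sum`).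

* `residue_faceCoeff_sub_mem` — if `f ≡ Σ_k q_k x^{bk} y^{ν-k}` modulo `𝒥_{bν+1}`, then the face coefficients of ANY unit
  expansion of `f` agree with the `q_k` MODULO `𝔪` (weighted quasi-regularity:
  `LocalGameEFTNewton.coeff_layer_sub_mem_maximalIdeal`);
* `sub_sum_mem_of_faceCoeff_sub_mem` — conversely, coefficients `q_k` agreeing modulo `𝔪` with the face coefficients give
  `f ≡ Σ_k q_k x^{bk} y^{ν-k}` modulo `𝒥_{bν+1}` (`eval_mem_weightedMonomialIdeal_succ_of_coeff_mem`: a weight-`bν` form with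
  coefficients in `𝔪` evaluates into `𝒥_{bν+1}`).

Read in `𝒪_{Y′,η′}` and lifted in `𝒪_{Y,η}` (file `…AQSBaseChangeDescent`), this is how a steepening / a tangent `ν`-fold line
found over `κ(η′)` descends to `κ(η)` through `…AQSBaseChangeBinomial`.  Def-free; no named facts; nothing here is a claim about
Hironaka's problem.  AI-written; weaker than expert review.
-/

noncomputable section

set_option linter.dupNamespace false -- mandated namespace of this single-conjunct summit

namespace Summit.ResolutionOfSingularities.ResolutionOfSingularities.Theorems.AQSBaseChange

open IsLocalRing Literature.AlgebraicGeometry.Resolution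
open Summit.ResolutionOfSingularities.ResolutionOfSingularities.Theorems.LocalGameEFTNewton
  (eval_monomial_equivFunOnFinite_symm weight_equivFunOnFinite_symm prod_two span_range_vecCons_eq
    coeff_layer_sub_mem_maximalIdeal le_weight_of_mem_weightedMonomialIdeal)

universe u

variable {T : Type u} [CommRing T]

/-! ## Binomial face forms -/

/-- The exponent `(bk, ν - k)` has `(1,b)`-weight `bν` for `k ≤ ν`. [folklore] -/
theorem weight_faceExp (b ν : ℕ) {k : ℕ} (hk : k ≤ ν) :
    ∑ i, (![1, b] : Fin 2 → ℕ) i * (![b * k, ν - k] : Fin 2 → ℕ) i = b * ν := by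
  rw [LocalGameEFTNewton.weight_two]
  simp only [Matrix.cons_val_zero, Matrix.cons_val_one]
  rw [Nat.mul_sub, ← Nat.add_sub_assoc (Nat.mul_le_mul_left b hk), Nat.add_sub_cancel_left]

/-- Face exponents are determined by `k`. [folklore] -/
theorem faceExp_injective (b ν : ℕ) {k k' : ℕ} (hk : k ≤ ν) (hk' : k' ≤ ν)
    (h : (![b * k, ν - k] : Fin 2 → ℕ) = ![b * k', ν - k']) : k = k' := by
  have h1 : ν - k = ν - k' := congrFun h 1
  omega

/-- An exponent of `(1,b)`-weight `bν` (`b ≥ 1`) is a face exponent `(bk, ν - k)`, `k ≤ ν`. [folklore] -/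
theorem exists_eq_faceExp {b : ℕ} (hb : 0 < b) {ν : ℕ} {α : Fin 2 → ℕ}
    (hα : ∑ i, (![1, b] : Fin 2 → ℕ) i * α i = b * ν) : ∃ k ≤ ν, α = ![b * k, ν - k] := by
  rw [LocalGameEFTNewton.weight_two] at hα
  have h1 : α 1 ≤ ν := by nlinarith
  have h0 : α 0 = b * (ν - α 1) := by rw [Nat.mul_sub]; omega
  have h1' : α 1 = ν - (ν - α 1) := by omega
  refine ⟨ν - α 1, Nat.sub_le _ _, ?_⟩
  funext i
  fin_cases i
  · simpa using h0
  · simpa using h1'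

/-- Evaluating the binomial face form. [folklore] -/
theorem eval_faceForm (x y : T) (b ν : ℕ) (q : ℕ → T) :
    MvPolynomial.eval ![x, y]
        (∑ k ∈ Finset.range (ν + 1),
          MvPolynomial.monomial (Finsupp.equivFunOnFinite.symm ![b * k, ν - k]) (q k)) =
      ∑ k ∈ Finset.range (ν + 1), q k * (x ^ (b * k) * y ^ (ν - k)) := by
  rw [map_sum]
  refine Finset.sum_congr rfl fun k _ => ?_
  rw [eval_monomial_equivFunOnFinite_symm, prod_two]
  simp

/-- The binomial face form is a `(1,b)`-form of weight `bν`. [folklore] -/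
theorem isWeightedHomogeneous_faceForm (b ν : ℕ) (q : ℕ → T) :
    MvPolynomial.IsWeightedHomogeneous (![1, b] : Fin 2 → ℕ)
      (∑ k ∈ Finset.range (ν + 1),
        MvPolynomial.monomial (Finsupp.equivFunOnFinite.symm ![b * k, ν - k]) (q k)) (b * ν) := by
  rw [← MvPolynomial.mem_weightedHomogeneousSubmodule]
  refine Submodule.sum_mem _ fun k hk => ?_
  rw [MvPolynomial.mem_weightedHomogeneousSubmodule]
  exact MvPolynomial.isWeightedHomogeneous_monomial _ _ _
    (by rw [weight_equivFunOnFinite_symm]; exact weight_faceExp b ν (Nat.lt_succ_iff.mp (Finset.mem_range.mp hk)))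

/-- The coefficient of the binomial face form at the face exponent `(bk, ν - k)`. [folklore] -/
theorem coeff_faceForm (b ν : ℕ) (q : ℕ → T) {k : ℕ} (hk : k ≤ ν) :
    MvPolynomial.coeff (Finsupp.equivFunOnFinite.symm ![b * k, ν - k])
        (∑ j ∈ Finset.range (ν + 1),
          MvPolynomial.monomial (Finsupp.equivFunOnFinite.symm ![b * j, ν - j]) (q j)) = q k := by
  classical
  rw [MvPolynomial.coeff_sum]
  rw [Finset.sum_eq_single k]
  · rw [MvPolynomial.coeff_monomial, if_pos rfl]
  · intro j hj hjk
    rw [MvPolynomial.coeff_monomial, if_neg]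
    intro h
    exact hjk (faceExp_injective b ν (Nat.lt_succ_iff.mp (Finset.mem_range.mp hj)) hk
      (Finsupp.equivFunOnFinite.symm.injective h))
  · intro h
    exact absurd (Finset.mem_range.mpr (Nat.lt_succ_of_le hk)) h

/-- Off the face exponents the binomial face form has no coefficients. [folklore] -/
theorem coeff_faceForm_eq_zero (b ν : ℕ) (q : ℕ → T) {β : Fin 2 → ℕ} (hβ : ∀ k ≤ ν, β ≠ ![b * k, ν - k]) :
    MvPolynomial.coeff (Finsupp.equivFunOnFinite.symm β)
        (∑ j ∈ Finset.range (ν + 1),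
          MvPolynomial.monomial (Finsupp.equivFunOnFinite.symm ![b * j, ν - j]) (q j)) = 0 := by
  classical
  rw [MvPolynomial.coeff_sum]
  refine Finset.sum_eq_zero fun j hj => ?_
  rw [MvPolynomial.coeff_monomial, if_neg]
  intro h
  exact hβ j (Nat.lt_succ_iff.mp (Finset.mem_range.mp hj)) (Finsupp.equivFunOnFinite.symm.injective h).symm

/-- `c·(y - λ x^b)^ν` as a binomial face form. [folklore] -/
theorem mul_sub_pow_eq_sum (x y c lam : T) (b ν : ℕ) :
    c * (y - lam * x ^ b) ^ ν =
      ∑ k ∈ Finset.range (ν + 1), (c * (ν.choose k : T) * (-lam) ^ k) * (x ^ (b * k) * y ^ (ν - k)) := by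
  rw [sub_eq_neg_add, ← neg_mul, add_pow, Finset.mul_sum]
  refine Finset.sum_congr rfl fun k _ => ?_
  rw [mul_pow, ← pow_mul, mul_comm b k]
  ring

/-- `c·(s x + t y)^ν` as a binomial face form (`b = 1`). [folklore] -/
theorem mul_linear_pow_eq_sum (x y c s t : T) (ν : ℕ) :
    c * (s * x + t * y) ^ ν =
      ∑ k ∈ Finset.range (ν + 1), (c * (ν.choose k : T) * s ^ k * t ^ (ν - k)) * (x ^ (1 * k) * y ^ (ν - k)) := by
  rw [add_pow, Finset.mul_sum]
  refine Finset.sum_congr rfl fun k _ => ?_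
  rw [mul_pow, mul_pow, one_mul]
  ring

/-! ## A form with coefficients in `𝔪` evaluates one step deeper -/

/-- **A `(1,b)`-form of weight `m` with all coefficients in `𝔪 = (x, y)` evaluates into `𝒥_{m+1}((x,y);(1,b))`**
(`b ≥ 1`: `𝔪 ⊆ 𝒥₁` and `𝒥₁ · 𝒥ₘ ⊆ 𝒥ₘ₊₁`). [folklore] -/
theorem eval_mem_weightedMonomialIdeal_succ_of_coeff_mem [IsLocalRing T] {x y : T}
    (hxy : Ideal.span {x, y} = maximalIdeal T) {b : ℕ} (hb : 0 < b) {m : ℕ} (R : MvPolynomial (Fin 2) T)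
    (hR : R.IsWeightedHomogeneous (![1, b] : Fin 2 → ℕ) m) (hcoeff : ∀ β, R.coeff β ∈ maximalIdeal T) :
    MvPolynomial.eval ![x, y] R ∈ weightedMonomialIdeal ![x, y] ![1, b] (m + 1) := by
  classical
  have hw : ∀ i, 0 < (![1, b] : Fin 2 → ℕ) i := by
    intro i; fin_cases i <;> simp [hb]
  have h𝔪 : maximalIdeal T ≤ weightedMonomialIdeal ![x, y] ![1, b] 1 := by
    have := pow_le_weightedMonomialIdeal_of_span_eq ![x, y] ![1, b] hw (span_range_vecCons_eq hxy) 1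
    rwa [pow_one] at this
  rw [MvPolynomial.as_sum R, map_sum]
  refine Ideal.sum_mem _ fun β hβ => ?_
  rw [MvPolynomial.eval_monomial]
  have hwβ : Finsupp.weight (![1, b] : Fin 2 → ℕ) β = m := hR (MvPolynomial.mem_support_iff.mp hβ)
  have hmono : (β.prod fun n e => (![x, y] : Fin 2 → T) n ^ e) ∈ weightedMonomialIdeal ![x, y] ![1, b] m := by
    have hβ' : β = Finsupp.equivFunOnFinite.symm (fun i => β i) := by
      ext i; simp
    have := prod_pow_mem_weightedMonomialIdeal ![x, y] ![1, b] (n := m) (fun i => β i) (by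
      rw [← weight_equivFunOnFinite_symm, ← hβ', hwβ])
    rw [Finsupp.prod_fintype _ _ (fun i => by simp)]
    exact this
  rw [add_comm]
  exact weightedMonomialIdeal_mul_le ![x, y] ![1, b] 1 m (Ideal.mul_mem_mul (h𝔪 (hcoeff β)) hmono)

/-! ## Reading the face of `f` modulo `𝔪`, and lifting it -/

section Face

variable [IsRegularLocalRing T] (hdim : ringKrullDim T = (2 : ℕ)) {x y : T}
  (hxy : Ideal.span {x, y} = maximalIdeal T)

include hdim hxy

/-- **The face coefficients modulo `𝔪` are determined by `f` modulo `𝒥_{bν+1}`.**  Let `f = Σ_{α ∈ Δ} a_α x^{α₀} y^{α₁} + r`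
be a unit expansion (`a_α` units, `r ∈ 𝔪^N`, `bν < N`) of `f ∈ 𝒥_{bν}((x,y);(1,b))`, and suppose
`f ≡ Σ_{k ≤ ν} q_k x^{bk} y^{ν-k}` modulo `𝒥_{bν+1}`.  Then for every `k ≤ ν` the face coefficient (`a_{(bk,ν-k)}`, or `0`
if `(bk, ν-k) ∉ Δ`) is congruent to `q_k` modulo `𝔪`. [cite: Matsumura1987, Thm. 16.2] -/
theorem residue_faceCoeff_sub_mem {f : T} {Δ : Finset (Fin 2 → ℕ)} {a : (Fin 2 → ℕ) → T} {N : ℕ}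
    (hunit : ∀ α ∈ Δ, IsUnit (a α)) (hr : f - ∑ α ∈ Δ, a α * ∏ i, (![x, y] : Fin 2 → T) i ^ α i ∈ maximalIdeal T ^ N)
    {b : ℕ} (hb : 0 < b) {ν : ℕ} (hN : b * ν < N) (hf : f ∈ weightedMonomialIdeal ![x, y] ![1, b] (b * ν))
    (q : ℕ → T)
    (hq : f - ∑ k ∈ Finset.range (ν + 1), q k * (x ^ (b * k) * y ^ (ν - k)) ∈
      weightedMonomialIdeal ![x, y] ![1, b] (b * ν + 1))
    {k : ℕ} (hk : k ≤ ν) :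
    (if (![b * k, ν - k] : Fin 2 → ℕ) ∈ Δ then a ![b * k, ν - k] else 0) - q k ∈ maximalIdeal T := by
  classical
  have hw : ∀ i, 0 < (![1, b] : Fin 2 → ℕ) i := by
    intro i; fin_cases i <;> simp [hb]
  have hu := span_range_vecCons_eq hxy
  have hge : ∀ α ∈ Δ, b * ν ≤ ∑ i, (![1, b] : Fin 2 → ℕ) i * α i :=
    le_weight_of_mem_weightedMonomialIdeal ![x, y] hu hdim ![1, b] hw hunit hr hf hN.le
  have hQ := isWeightedHomogeneous_faceForm (T := T) b ν q
  have hfQ : f - MvPolynomial.eval ![x, y] (∑ k ∈ Finset.range (ν + 1),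
      MvPolynomial.monomial (Finsupp.equivFunOnFinite.symm ![b * k, ν - k]) (q k)) ∈
        weightedMonomialIdeal ![x, y] ![1, b] (b * ν + 1) := by
    rw [eval_faceForm]; exact hq
  have key := coeff_layer_sub_mem_maximalIdeal ![x, y] hu hdim ![1, b] hw hr hge hN _ hQ hfQ
    (Finsupp.equivFunOnFinite.symm ![b * k, ν - k])
  rw [MvPolynomial.coeff_sub, coeff_faceForm b ν q hk, MvPolynomial.coeff_sum] at key
  have hP : ∑ α ∈ Δ.filter (fun α => ∑ i, (![1, b] : Fin 2 → ℕ) i * α i = b * ν),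
      MvPolynomial.coeff (Finsupp.equivFunOnFinite.symm ![b * k, ν - k])
        (MvPolynomial.monomial (Finsupp.equivFunOnFinite.symm α) (a α)) =
      if (![b * k, ν - k] : Fin 2 → ℕ) ∈ Δ then a ![b * k, ν - k] else 0 := by
    simp_rw [MvPolynomial.coeff_monomial, (Finsupp.equivFunOnFinite.symm.injective).eq_iff]
    rw [Finset.sum_ite_eq' (Δ.filter _) (![b * k, ν - k] : Fin 2 → ℕ) a]
    simp only [Finset.mem_filter, weight_faceExp b ν hk, and_true]
  rwa [hP] at key

/-- **Lifting congruent coefficients.**  Conversely, if `f = Σ_{α ∈ Δ} a_α x^{α₀} y^{α₁} + r` is a unit expansion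
(`r ∈ 𝔪^N`, `bν + 1 ≤ N`) of `f ∈ 𝒥_{bν}((x,y);(1,b))` and `q_k` agrees modulo `𝔪` with the face coefficient at `(bk, ν-k)`
for every `k ≤ ν`, then `f ≡ Σ_{k ≤ ν} q_k x^{bk} y^{ν-k}` modulo `𝒥_{bν+1}`. [cite: Matsumura1987, Thm. 16.2] -/
theorem sub_sum_mem_of_faceCoeff_sub_mem {f : T} {Δ : Finset (Fin 2 → ℕ)} {a : (Fin 2 → ℕ) → T} {N : ℕ}
    (hunit : ∀ α ∈ Δ, IsUnit (a α)) (hr : f - ∑ α ∈ Δ, a α * ∏ i, (![x, y] : Fin 2 → T) i ^ α i ∈ maximalIdeal T ^ N)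
    {b : ℕ} (hb : 0 < b) {ν : ℕ} (hN : b * ν + 1 ≤ N) (hf : f ∈ weightedMonomialIdeal ![x, y] ![1, b] (b * ν))
    (q : ℕ → T)
    (hq : ∀ k ≤ ν, (if (![b * k, ν - k] : Fin 2 → ℕ) ∈ Δ then a ![b * k, ν - k] else 0) - q k ∈ maximalIdeal T) :
    f - ∑ k ∈ Finset.range (ν + 1), q k * (x ^ (b * k) * y ^ (ν - k)) ∈
      weightedMonomialIdeal ![x, y] ![1, b] (b * ν + 1) := by
  classical
  have hw : ∀ i, 0 < (![1, b] : Fin 2 → ℕ) i := by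
    intro i; fin_cases i <;> simp [hb]
  have hu := span_range_vecCons_eq hxy
  have hge : ∀ α ∈ Δ, b * ν ≤ ∑ i, (![1, b] : Fin 2 → ℕ) i * α i :=
    le_weight_of_mem_weightedMonomialIdeal ![x, y] hu hdim ![1, b] hw hunit hr hf (by omega)
  -- split the expansion into the face layer and the higher terms
  set P : MvPolynomial (Fin 2) T := ∑ α ∈ Δ.filter (fun α => ∑ i, (![1, b] : Fin 2 → ℕ) i * α i = b * ν),
    MvPolynomial.monomial (Finsupp.equivFunOnFinite.symm α) (a α) with hPdef
  set Q : MvPolynomial (Fin 2) T := ∑ k ∈ Finset.range (ν + 1),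
    MvPolynomial.monomial (Finsupp.equivFunOnFinite.symm ![b * k, ν - k]) (q k) with hQdef
  have hP : P.IsWeightedHomogeneous (![1, b] : Fin 2 → ℕ) (b * ν) := by
    rw [← MvPolynomial.mem_weightedHomogeneousSubmodule]
    refine Submodule.sum_mem _ fun α hα => ?_
    rw [MvPolynomial.mem_weightedHomogeneousSubmodule]
    exact MvPolynomial.isWeightedHomogeneous_monomial _ _ (a α)
      (by rw [weight_equivFunOnFinite_symm, (Finset.mem_filter.mp hα).2])
  have hevalP : MvPolynomial.eval ![x, y] P =
      ∑ α ∈ Δ.filter (fun α => ∑ i, (![1, b] : Fin 2 → ℕ) i * α i = b * ν),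
        a α * ∏ i, (![x, y] : Fin 2 → T) i ^ α i := by
    simp only [hPdef, map_sum, eval_monomial_equivFunOnFinite_symm]
  have hevalQ : MvPolynomial.eval ![x, y] Q = ∑ k ∈ Finset.range (ν + 1), q k * (x ^ (b * k) * y ^ (ν - k)) := by
    rw [hQdef, eval_faceForm]
  have hhigh : ∑ α ∈ Δ.filter (fun α => ¬ ∑ i, (![1, b] : Fin 2 → ℕ) i * α i = b * ν),
      a α * ∏ i, (![x, y] : Fin 2 → T) i ^ α i ∈ weightedMonomialIdeal ![x, y] ![1, b] (b * ν + 1) := by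
    refine Ideal.sum_mem _ fun α hα => Ideal.mul_mem_left _ _ ?_
    obtain ⟨hαΔ, hne⟩ := Finset.mem_filter.mp hα
    exact prod_pow_mem_weightedMonomialIdeal ![x, y] ![1, b] α
      (Nat.succ_le_of_lt (lt_of_le_of_ne (hge α hαΔ) (Ne.symm hne)))
  have hrem : f - ∑ α ∈ Δ, a α * ∏ i, (![x, y] : Fin 2 → T) i ^ α i ∈
      weightedMonomialIdeal ![x, y] ![1, b] (b * ν + 1) :=
    ((Ideal.pow_le_pow_right hN).trans (pow_le_weightedMonomialIdeal_of_span_eq ![x, y] ![1, b] hw hu _)) hr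
  -- all coefficients of `P - Q` lie in `𝔪`
  have hcoeff : ∀ β, (P - Q).coeff β ∈ maximalIdeal T := by
    intro β
    obtain ⟨β', rfl⟩ : ∃ β' : Fin 2 → ℕ, β = Finsupp.equivFunOnFinite.symm β' :=
      ⟨β, (Finsupp.equivFunOnFinite.symm_apply_apply β).symm⟩
    rw [MvPolynomial.coeff_sub]
    have hPβ : P.coeff (Finsupp.equivFunOnFinite.symm β') =
        if β' ∈ Δ.filter (fun α => ∑ i, (![1, b] : Fin 2 → ℕ) i * α i = b * ν) then a β' else 0 := by
      rw [hPdef, MvPolynomial.coeff_sum]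
      simp_rw [MvPolynomial.coeff_monomial, (Finsupp.equivFunOnFinite.symm.injective).eq_iff]
      exact Finset.sum_ite_eq' _ β' a
    by_cases hface : ∃ k ≤ ν, β' = ![b * k, ν - k]
    · obtain ⟨k, hk, rfl⟩ := hface
      rw [hPβ, hQdef, coeff_faceForm b ν q hk]
      simp only [Finset.mem_filter, weight_faceExp b ν hk, and_true]
      exact hq k hk
    · push Not at hface
      rw [hPβ, hQdef, coeff_faceForm_eq_zero b ν q hface, sub_zero]
      rw [if_neg]
      · exact Ideal.zero_mem _
      · intro hmem
        obtain ⟨k, hk, hk'⟩ := exists_eq_faceExp hb (Finset.mem_filter.mp hmem).2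
        exact hface k hk hk'
  have hPQ : (P - Q).IsWeightedHomogeneous (![1, b] : Fin 2 → ℕ) (b * ν) := by
    have hQ := isWeightedHomogeneous_faceForm (T := T) b ν q
    rw [← MvPolynomial.mem_weightedHomogeneousSubmodule] at hP hQ ⊢
    exact Submodule.sub_mem _ hP hQ
  have hevalPQ := eval_mem_weightedMonomialIdeal_succ_of_coeff_mem hxy hb (P - Q) hPQ hcoeff
  rw [map_sub, hevalP, hevalQ] at hevalPQ
  -- assemble
  have hsplit : ∑ α ∈ Δ, a α * ∏ i, (![x, y] : Fin 2 → T) i ^ α i =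
      ∑ α ∈ Δ.filter (fun α => ∑ i, (![1, b] : Fin 2 → ℕ) i * α i = b * ν),
          a α * ∏ i, (![x, y] : Fin 2 → T) i ^ α i +
        ∑ α ∈ Δ.filter (fun α => ¬ ∑ i, (![1, b] : Fin 2 → ℕ) i * α i = b * ν),
          a α * ∏ i, (![x, y] : Fin 2 → T) i ^ α i :=
    (Finset.sum_filter_add_sum_filter_not Δ _ _).symm
  have hkey : f - ∑ k ∈ Finset.range (ν + 1), q k * (x ^ (b * k) * y ^ (ν - k)) =
      (f - ∑ α ∈ Δ, a α * ∏ i, (![x, y] : Fin 2 → T) i ^ α i) +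
        ∑ α ∈ Δ.filter (fun α => ¬ ∑ i, (![1, b] : Fin 2 → ℕ) i * α i = b * ν),
          a α * ∏ i, (![x, y] : Fin 2 → T) i ^ α i +
        (∑ α ∈ Δ.filter (fun α => ∑ i, (![1, b] : Fin 2 → ℕ) i * α i = b * ν),
          a α * ∏ i, (![x, y] : Fin 2 → T) i ^ α i -
          ∑ k ∈ Finset.range (ν + 1), q k * (x ^ (b * k) * y ^ (ν - k))) := by
    rw [hsplit]; ring
  rw [hkey]
  exact Ideal.add_mem _ (Ideal.add_mem _ hrem hhigh) hevalPQ

end Face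

end Summit.ResolutionOfSingularities.ResolutionOfSingularities.Theorems.AQSBaseChange

end
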